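import Summits.BirchSwinnertonDyer.BirchSwinnertonDyer.Theorems.TameQuarticSolventTprimeThreeTorsionValuationAtThree
import Literature.NumberTheory.EllipticCurves.SupersingularInertiaShapeExponentProofs
import Literature.NumberTheory.EllipticCurves.SupersingularInertiaShapeFrobeniusTwistProofs
import HarnessLib

/-!
# Route `TameQuarticManinParity`, LINE 23 (bsd-idea-3 g8), analytic half of W23b / W23a on the TAME sub-row, part 1:
# the (t′) good model over `K̄_v` and the TWISTED-EQUIVARIANT transport `E(ℚ̄) → W'(K̄_v)`
# (`--supports` W23b stmt-BirchSwinnertonDyer-28281; also W23a stmt-28283)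

Cell `pub/bsd-wall`, D-0145 line `route-BirchSwinnertonDyer-TeichmullerTwistDescent`, seat `bsd-line-ttd-p1` g11.
THEOREMS ONLY (no definition, no named fact, no `sorry`). BSD is NOT proved by this; Manin's conjecture is not
proved; W23b (28281) / W23a (28283) stay OPEN as typed. This file is the local-model half of Serre's additive
embedding `θ : E[3] ↪ k` for the tame quartic class (t′) at `3` (sequel: `…TprimeSerreWeightSubrowB`, which builds
`θ`, proves `θ(σX) = ψ₂(σ)⁷ θ(X)` on Kodaira III / `ψ₂(σ)³ θ(X)` on III*, and reads off Serre weight `6` / `2`).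

WHAT. `W/ℚ` globally minimal elliptic, `Addv W 3`, `SubTprime W 3` (`ord₃ Δ ∈ {3, 9}`, `e = 4`, potentially
supersingular), on SUB-ROW B of the cell's `(c₄, c₆)` split (`c₆ = 0 ∨ 2·ord₃ c₆ ≠ ord₃ Δ + 3`: no canonical
subgroup); `v` the place over `3`, `w` the spectral valuation of `K̄_v`, `ϖ ∈ K̄_v` with `ϖ⁴ = 3`.
`exists_tprime_subrowB_transport`: there are `k ∈ {1, 3}` (`ord₃ Δ = 3k`), a `w`-integral equation `W'` over `K̄_v`
and an injective additive `A : E(ℚ̄) → W'(K̄_v)` with `A(E[3]) ⊂ E₁(W')`, `|z(A X)|² = |ϖ|` on `E[3] ∖ 0`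
(`z = -x/y`), and `z(A(σX)) = (ϖ/σϖ)ᵏ · σ(z(A X))` for `σ ∈ Γ_{ℚ_v}`.

HOW. The cell's good model over the quartic ring (`tprime_goodModel_formalMul_three_dichotomy`, TQS files) with
`O = 𝒪_w`, `φ : ℤ₃ → O` through Mathlib's `ℚ_[3] ≃ ℚ_v` (`exists_ringHom_padic_adicCompletion`): `V/ℤ₃` with
`V ⊗ ℚ₃ = W ⊗ ℚ₃`, `T ∈ VarChange(ℤ₃)` with `(T • V).a₁ = (T • V).a₃ = 0`, `W'/O` with `ϖ^{ik} aᵢ' = φ((T • V).aᵢ)` and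
unit discriminant. `A = e₂ ∘ Φ₀ ∘ pointsMap`: `Φ₀ : E(K̄_v) ≃ S(K̄_v)` the EQUIVARIANT transport to the `ℚ_v`-model
`S = (T • V) ⊗ ℚ_v` (`VariableChange.pointEquivBaseChange`, as in `exists_goodReduction_localModel`), `e₂` the
rescaling `U = (ϖᵏ, 0, 0, 0)` with `U • S_{K̄_v} = W' ⊗ K̄_v` (so `z ↦ ϖᵏ z` exactly). Valuations: on sub-row B
every point of order `3` of `W' ⊗ K̄_v` has `|x| · |ϖ| = 1` — the cell's `norm_threeTorsion_of_subrowB` read through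
the spectral norm (`val_x_mul_val_eq_one_of_addOrderOf_eq_three`) — hence `E₁` membership and `|z|² = |ϖ|`
(`val_X_mul_val_zCoord_sq`). [cite: SerreInventiones1972, §1.10] [cite: SilvermanAEC2009, IV.6.1, VII.2.2, III.1]
-/
set_option linter.dupNamespace false
set_option autoImplicit false

noncomputable section
open scoped Classical NNReal NumberField

namespace Summit.BirchSwinnertonDyer.BirchSwinnertonDyer.Theorems.TameQuarticManinParity

open _root_.WeierstrassCurve Literature.NumberTheory.GaloisRepresentations Field
  IsDedekindDomain IsDedekindDomain.HeightOneSpectrum Rat.HeightOneSpectrum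
  Literature.NumberTheory.EllipticCurves
  Literature.NumberTheory.GaloisRepresentations.IsNonarchimedeanLocalField
  Literature.NumberTheory.GaloisRepresentations.ModPGaloisRep ValuativeRel
  Summit.BirchSwinnertonDyer.BirchSwinnertonDyer.Theorems.SolventPairLowerBound

/-- **`ℚ_[p] → ℚ_v` integrally**: for the place `v` of `ℚ` over `p`, Mathlib's `padicEquiv` gives a ring map
`ℚ_[p] →+* ℚ_v` sending `ℤ_[p]` into `𝓞_v`. [folklore] -/
theorem exists_ringHom_padic_adicCompletion (v : HeightOneSpectrum (𝓞 ℚ)) (p : ℕ) [Fact p.Prime]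
    (hv : (primesEquiv v : ℕ) = p) :
    ∃ j : ℚ_[p] →+* v.adicCompletion ℚ, ∀ x : ℤ_[p], j x ∈ v.adicCompletionIntegers ℚ := by
  subst hv
  refine ⟨((adicCompletion.padicEquiv v).toAlgEquiv.symm : ℚ_[(primesEquiv v : ℕ)] →ₐ[ℚ]
    v.adicCompletion ℚ).toRingHom, fun x ↦ ?_⟩
  have hx : (x : ℚ_[(primesEquiv v : ℕ)]) ∈ PadicInt.subring (primesEquiv v : ℕ) := x.2
  obtain ⟨y, hy, hyx⟩ := (adicCompletion.padicEquiv_bijOn v).surjOn hx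
  have : ((adicCompletion.padicEquiv v).toAlgEquiv.symm : ℚ_[(primesEquiv v : ℕ)] →ₐ[ℚ]
      v.adicCompletion ℚ).toRingHom (x : ℚ_[(primesEquiv v : ℕ)]) = y := by
    change (adicCompletion.padicEquiv v).toAlgEquiv.symm (x : ℚ_[(primesEquiv v : ℕ)]) = y
    rw [AlgEquiv.symm_apply_eq]
    exact hyx.symm
  rw [this]
  exact hy

section TorsionValuation

open scoped Valued

/-- **Sub-row B torsion valuation on `K̄_v`.** For the spectral valuation `w` of `K̄_v` (`v ∣ 3`), a
`w`-integral model `W'` with `a₁ = a₃ = 0`, unit discriminant, `3 = ϖ⁴` for some `ϖ` with `0 < |ϖ| < 1` and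
`3 ∣ a₂` (sub-row B): every point `(x, y)` of order `3` of `W' ⊗ K̄_v` has `|x| · |ϖ| = 1` — the valuation
form of `norm_threeTorsion_of_subrowB` (cell bsd-wall, TQS files), read through the spectral norm.
[cite: SerreInventiones1972, §1] [cite: SilvermanAEC2009, IV.6.1] -/
theorem val_x_mul_val_eq_one_of_addOrderOf_eq_three (v : HeightOneSpectrum (𝓞 ℚ))
    {w : Valuation (AlgebraicClosure (v.adicCompletion ℚ)) ℝ≥0}
    (hw : ∀ x, (w x : ℝ) = spectralNorm (v.adicCompletion ℚ) (AlgebraicClosure (v.adicCompletion ℚ)) x)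
    (W' : WeierstrassCurve w.valuationSubring) (hΔ : IsUnit W'.Δ) (ha₁ : W'.a₁ = 0) (ha₃ : W'.a₃ = 0)
    {ϖ : w.valuationSubring} (hϖ0 : 0 < w (ϖ : AlgebraicClosure (v.adicCompletion ℚ)))
    (hϖ1 : w (ϖ : AlgebraicClosure (v.adicCompletion ℚ)) < 1)
    (h3 : (3 : w.valuationSubring) = ϖ ^ 4 * 1) (ha₂ : (3 : w.valuationSubring) ∣ W'.a₂)
    {x y : AlgebraicClosure (v.adicCompletion ℚ)}
    (h : (W'.map (algebraMap w.valuationSubring (AlgebraicClosure (v.adicCompletion ℚ)))).toAffine.Nonsingular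
      x y)
    (h3P : addOrderOf (Affine.Point.some x y h) = 3) :
    w x * w (ϖ : AlgebraicClosure (v.adicCompletion ℚ)) = 1 := by
  classical
  have hvO : w.Integers w.valuationSubring := Valuation.valuationSubring.integers w
  letI : NormedField (AlgebraicClosure (v.adicCompletion ℚ)) :=
    spectralNorm.normedField (v.adicCompletion ℚ) (AlgebraicClosure (v.adicCompletion ℚ))
  have hnw : ∀ z : AlgebraicClosure (v.adicCompletion ℚ), ‖z‖ = (w z : ℝ) := fun z ↦ (hw z).symm
  haveI : IsUltrametricDist (AlgebraicClosure (v.adicCompletion ℚ)) :=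
    IsUltrametricDist.isUltrametricDist_of_forall_norm_add_le_max_norm fun a b ↦
      isNonarchimedean_spectralNorm a b
  have hψ : ∀ z : w.valuationSubring,
      ‖algebraMap w.valuationSubring (AlgebraicClosure (v.adicCompletion ℚ)) z‖ ≤ 1 := by
    intro z
    rw [hnw]
    exact_mod_cast hvO.map_le_one z
  have hϖ0' : 0 < ‖algebraMap w.valuationSubring (AlgebraicClosure (v.adicCompletion ℚ)) ϖ‖ := by
    rw [hnw]; exact_mod_cast hϖ0
  have hϖ1' : ‖algebraMap w.valuationSubring (AlgebraicClosure (v.adicCompletion ℚ)) ϖ‖ < 1 := by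
    rw [hnw]; exact_mod_cast hϖ1
  have key := (norm_threeTorsion_of_subrowB
    (algebraMap w.valuationSubring (AlgebraicClosure (v.adicCompletion ℚ))) hψ isUnit_one h3 hϖ0' hϖ1'
    W' hΔ ha₁ ha₃ ha₂ h h3P).1
  rw [hnw, hnw] at key
  exact_mod_cast key

end TorsionValuation

set_option maxHeartbeats 1600000 in
/-- **The (t′) good model over `K̄_v` and the twisted-equivariant transport, sub-row B.** For `W/ℚ` globally minimal
elliptic with `Addv W 3`, `SubTprime W 3`, on sub-row B (`c₆ = 0 ∨ 2·ord₃ c₆ ≠ ord₃ Δ + 3`), the place `v` over `3`,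
the spectral valuation `w` of `K̄_v` and any `ϖ ∈ K̄_v` with `ϖ⁴ = 3`: there are `k ∈ {1, 3}` (`ord₃ Δ = 3k`), a
`w`-integral Weierstrass equation `W'` over `K̄_v` (the cell's good model over the quartic ring `𝒪_w`, rescaled by
`ϖᵏ` from the `ℚ₃`-model `T • V` of `tprime_goodModel_formalMul_three_dichotomy`) and an injective additive map
`A : E(ℚ̄) → W'(K̄_v)` with: `A(E[3]) ⊂ E₁(W')` (kernel of reduction), `|z(A X)|² = |ϖ|` on `E[3] ∖ 0`
(`z = -x/y`; from `|x| · |ϖ| = 1`, `val_x_mul_val_eq_one_of_addOrderOf_eq_three`), and the TWISTED equivariance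
`z(A(σ X)) = (ϖ/σϖ)ᵏ · σ(z(A X))` for `σ ∈ Γ_{ℚ_v}` (the transport to `T • V` is equivariant, the rescaling by `ϖᵏ`
is not). [cite: SilvermanAEC2009, IV.6.1, Prop. VII.2.2, III.1 Table 3.1] [cite: SerreInventiones1972, §1.10] -/
theorem exists_tprime_subrowB_transport
    (W : WeierstrassCurve ℚ) [W.IsElliptic] [W.IsGloballyMinimal]
    (hadd : Rank1Residual.Addv W 3) (hsub : Summit.BirchSwinnertonDyer.Rank1Residual.Additive.SubTprime W 3)
    (hB : W.c₆ = 0 ∨ 2 * padicValRat 3 W.c₆ ≠ padicValRat 3 W.Δ + 3)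
    (v : HeightOneSpectrum (𝓞 ℚ)) (hv : (primesEquiv v : ℕ) = 3)
    {w : Valuation (AlgebraicClosure (v.adicCompletion ℚ)) ℝ≥0}
    (hw : ∀ x, (w x : ℝ) = spectralNorm (v.adicCompletion ℚ) (AlgebraicClosure (v.adicCompletion ℚ)) x)
    {ϖL : AlgebraicClosure (v.adicCompletion ℚ)}
    (hϖL4 : ϖL ^ 4 = ((3 : ℕ) : AlgebraicClosure (v.adicCompletion ℚ))) :
    ∃ (kk : ℕ) (W'L : WeierstrassCurve (AlgebraicClosure (v.adicCompletion ℚ)))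
      (_ : W'L.IsIntegral w.integer) (A : geomPoints W →+ W'L.toAffine.Point),
      ((padicValRat 3 W.Δ = 3 ∧ kk = 1) ∨ (padicValRat 3 W.Δ = 9 ∧ kk = 3)) ∧
      Function.Injective A ∧
      (∀ X ∈ geomTorsion W 3, A X ∈ FormalGroupChart.kernel w W'L) ∧
      (∀ X ∈ geomTorsion W 3, X ≠ 0 → w (A X).zCoord ^ 2 = w ϖL) ∧
      (∀ (σ : absoluteGaloisGroup (v.adicCompletion ℚ)) (X : geomPoints W),
        (A (absGaloisRestrict ℚ (v.adicCompletion ℚ) σ • X)).zCoord =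
          (ϖL / (σ • ϖL)) ^ kk * (σ • (A X).zCoord)) := by
  classical
  haveI : Fact (Nat.Prime 3) := ⟨Nat.prime_three⟩
  have hpv : ((3 : ℕ) : 𝓞 ℚ) ∈ v.asIdeal := by
    have h : v = (primesEquiv (R := 𝓞 ℚ)).symm ⟨3, Nat.prime_three⟩ := by
      rw [Equiv.eq_symm_apply]; exact Subtype.ext hv
    exact (natCast_mem_asIdeal_iff_eq_primesEquiv_symm v Nat.prime_three).mpr h
  /- Step 0: `|3| < 1`, `0 < |ϖ| < 1`, the ring `O = 𝒪_w` and `ϖ ∈ O`, `3 = ϖ⁴ · 1`. -/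
  have hvO : w.Integers w.valuationSubring := Valuation.valuationSubring.integers w
  have h3w : w ((3 : ℕ) : AlgebraicClosure (v.adicCompletion ℚ)) < 1 := by
    have h := spectralValuation_algebraMap_ringOfIntegers_lt_one (v := v) hw hpv
    rwa [map_natCast] at h
  have h3L : ((3 : ℕ) : AlgebraicClosure (v.adicCompletion ℚ)) ≠ 0 := by
    rw [← map_natCast (algebraMap ℚ (AlgebraicClosure (v.adicCompletion ℚ))), map_ne_zero]
    norm_num
  have hϖL0 : ϖL ≠ 0 := by
    intro h0; rw [h0, zero_pow four_ne_zero] at hϖL4; exact h3L hϖL4.symm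
  have hwϖ0 : 0 < w ϖL := (Valuation.pos_iff _).mpr hϖL0
  have hwϖ1 : w ϖL < 1 := by
    by_contra hle
    rw [not_lt] at hle
    have : 1 ≤ w ϖL ^ 4 := one_le_pow₀ hle
    rw [← Valuation.map_pow, hϖL4] at this
    exact absurd h3w (not_lt.mpr this)
  -- the ring `O = 𝒪_w` and `ϖ ∈ O`
  set O : ValuationSubring (AlgebraicClosure (v.adicCompletion ℚ)) := w.valuationSubring with hOdef
  have hmemO : ∀ x, x ∈ O ↔ w x ≤ 1 := fun x ↦ Valuation.mem_valuationSubring_iff w x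
  let ϖ : O := ⟨ϖL, (hmemO _).mpr hwϖ1.le⟩
  have hϖcoe : ((ϖ : O) : AlgebraicClosure (v.adicCompletion ℚ)) = ϖL := rfl
  have h3O : (3 : O) = ϖ ^ 4 * 1 := by
    apply Subtype.ext
    rw [mul_one]
    change (3 : AlgebraicClosure (v.adicCompletion ℚ)) = ((ϖ ^ 4 : O) : AlgebraicClosure _)
    rw [SubmonoidClass.coe_pow, hϖcoe, hϖL4, Nat.cast_ofNat]
  have hϖunit : ¬ IsUnit ϖ := by
    intro hu
    have h1 : w (ϖ : AlgebraicClosure (v.adicCompletion ℚ)) = 1 :=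
      (Valuation.Integers.isUnit_iff_valuation_eq_one hvO).mp hu
    rw [hϖcoe] at h1
    exact absurd hwϖ1 (by rw [h1]; exact lt_irrefl 1)
  /- the integral map `φ : ℤ_[3] → O` through `ℚ_[3] ≃ ℚ_v ⊂ K̄_v` -/
  obtain ⟨j, hj⟩ := exists_ringHom_padic_adicCompletion v 3 hv
  let jL : ℚ_[3] →+* AlgebraicClosure (v.adicCompletion ℚ) :=
    (algebraMap (v.adicCompletion ℚ) (AlgebraicClosure (v.adicCompletion ℚ))).comp j
  have hjL_int : ∀ x : ℤ_[3], w (jL x) ≤ 1 := fun x ↦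
    (spectralValuation_algebraMap_le_one_iff hw _).mpr (hj x)
  let jF : ℤ_[3] →+* v.adicCompletion ℚ := j.comp (algebraMap ℤ_[3] ℚ_[3])
  let φ : ℤ_[3] →+* O := ((algebraMap (v.adicCompletion ℚ) (AlgebraicClosure (v.adicCompletion ℚ))).comp
      jF).codRestrict O.toSubring fun x ↦ (hmemO _).mpr (hjL_int x)
  have hφ : ∀ x : ℤ_[3], ((φ x : O) : AlgebraicClosure (v.adicCompletion ℚ)) =
      algebraMap (v.adicCompletion ℚ) (AlgebraicClosure (v.adicCompletion ℚ)) (jF x) := fun x ↦ rfl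
  /- Step 1: the (t′) good model `W'` over `O` and the `ℚ₃`-model `S = T • V`. -/
  obtain ⟨V, T, kk, m, W', hVmap, hkm, hΔval, hSa₁, hSa₃, hW'a₁, hW'a₃, ha₂, ha₄, ha₆, hunit, hcases⟩ :=
    tprime_goodModel_formalMul_three_dichotomy W hadd hsub φ isUnit_one h3O hϖunit
  /- Step 2: the `ℚ_v`-model `S = (T • V) ⊗ ℚ_v`, `T_v • W_v = S`, and the equivariant transport `Φ₀`. -/
  set S : WeierstrassCurve (v.adicCompletion ℚ) := (T • V).map jF with hSdef
  have hVF : V.map jF = W.baseChange (v.adicCompletion ℚ) := by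
    change V.map (j.comp (algebraMap ℤ_[3] ℚ_[3])) = _
    rw [← WeierstrassCurve.map_map, hVmap, WeierstrassCurve.baseChange, WeierstrassCurve.map_map,
      WeierstrassCurve.baseChange]
    congr 1
    exact Subsingleton.elim _ _
  have hCM : T.map jF • W.baseChange (v.adicCompletion ℚ) = S := by
    rw [hSdef, ← WeierstrassCurve.map_variableChange, hVF]
  have hCM' := congrArg (fun Y : WeierstrassCurve (v.adicCompletion ℚ) ↦
    Y.baseChange (AlgebraicClosure (v.adicCompletion ℚ))) hCM
  set SL : WeierstrassCurve (AlgebraicClosure (v.adicCompletion ℚ)) :=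
    S.baseChange (AlgebraicClosure (v.adicCompletion ℚ)) with hSLdef
  set W'L : WeierstrassCurve (AlgebraicClosure (v.adicCompletion ℚ)) :=
    W'.map (algebraMap O (AlgebraicClosure (v.adicCompletion ℚ))) with hW'Ldef
  let Φ₀ : localPoints W (v.adicCompletion ℚ) ≃+ SL.toAffine.Point :=
    ((Affine.Point.congrEquiv (baseChange_baseChange_adicCompletion W v).symm).trans
      (VariableChange.pointEquivBaseChange (W.baseChange (v.adicCompletion ℚ)) (T.map jF)
        (AlgebraicClosure (v.adicCompletion ℚ)))).trans
      (Affine.Point.congrEquiv hCM')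
  have hΦ₀ : ∀ (σ : absoluteGaloisGroup (v.adicCompletion ℚ))
      (Q : localPoints W (v.adicCompletion ℚ)),
      Φ₀ (σ • Q) = Affine.Point.map
        ((absoluteGaloisGroup.toAlgEquiv (v.adicCompletion ℚ) σ :
            AlgebraicClosure (v.adicCompletion ℚ) ≃ₐ[v.adicCompletion ℚ]
              AlgebraicClosure (v.adicCompletion ℚ)) :
          AlgebraicClosure (v.adicCompletion ℚ) →ₐ[v.adicCompletion ℚ]
            AlgebraicClosure (v.adicCompletion ℚ)) (Φ₀ Q) := by
    intro σ Q
    change Affine.Point.congrEquiv hCM' (VariableChange.pointEquivBaseChange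
        (W.baseChange (v.adicCompletion ℚ)) (T.map jF) (AlgebraicClosure (v.adicCompletion ℚ))
        (Affine.Point.congrEquiv (baseChange_baseChange_adicCompletion W v).symm (σ • Q))) =
      Affine.Point.map _ (Affine.Point.congrEquiv hCM'
        (VariableChange.pointEquivBaseChange (W.baseChange (v.adicCompletion ℚ)) (T.map jF)
          (AlgebraicClosure (v.adicCompletion ℚ))
          (Affine.Point.congrEquiv (baseChange_baseChange_adicCompletion W v).symm Q)))
    rw [congrEquiv_smul, VariableChange.pointEquivBaseChange_map_algEquiv]
    exact Affine.Point.congrEquiv_baseChange_map hCM _ _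
  /- Step 3: the rescaling `U = (ϖ^k, 0, 0, 0)` over `K̄_v`: `U • S_{K̄_v} = W' ⊗ K̄_v`. -/
  have hSL : SL = (T • V).map ((algebraMap (v.adicCompletion ℚ)
      (AlgebraicClosure (v.adicCompletion ℚ))).comp jF) := by
    rw [hSLdef, hSdef, WeierstrassCurve.baseChange, WeierstrassCurve.map_map]
  have hSLa₁ : SL.a₁ = 0 := by rw [hSL, WeierstrassCurve.map_a₁, hSa₁, map_zero]
  have hSLa₃ : SL.a₃ = 0 := by rw [hSL, WeierstrassCurve.map_a₃, hSa₃, map_zero]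
  have hSLa₂ : SL.a₂ = ϖL ^ (2 * kk) * W'L.a₂ := by
    rw [hSL, WeierstrassCurve.map_a₂, hW'Ldef, WeierstrassCurve.map_a₂, RingHom.comp_apply, ← hφ, ← ha₂]
    simp only [ValuationSubring.algebraMap_apply]
    rfl
  have hSLa₄ : SL.a₄ = ϖL ^ (4 * kk) * W'L.a₄ := by
    rw [hSL, WeierstrassCurve.map_a₄, hW'Ldef, WeierstrassCurve.map_a₄, RingHom.comp_apply, ← hφ, ← ha₄]
    simp only [ValuationSubring.algebraMap_apply]
    rfl
  have hSLa₆ : SL.a₆ = ϖL ^ (6 * kk) * W'L.a₆ := by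
    rw [hSL, WeierstrassCurve.map_a₆, hW'Ldef, WeierstrassCurve.map_a₆, RingHom.comp_apply, ← hφ, ← ha₆]
    simp only [ValuationSubring.algebraMap_apply]
    rfl
  have hW'La₁ : W'L.a₁ = 0 := by rw [hW'Ldef, WeierstrassCurve.map_a₁, hW'a₁, map_zero]
  have hW'La₃ : W'L.a₃ = 0 := by rw [hW'Ldef, WeierstrassCurve.map_a₃, hW'a₃, map_zero]
  have hϖk0 : ϖL ^ kk ≠ 0 := pow_ne_zero _ hϖL0
  let U : VariableChange (AlgebraicClosure (v.adicCompletion ℚ)) :=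
    { u := Units.mk0 (ϖL ^ kk) hϖk0, r := 0, s := 0, t := 0 }
  have hUu : ((U.u⁻¹ : (AlgebraicClosure (v.adicCompletion ℚ))ˣ) : AlgebraicClosure (v.adicCompletion ℚ))
      = (ϖL ^ kk)⁻¹ := by
    rw [Units.val_inv_eq_inv_val]; rfl
  have hU : U • SL = W'L := by
    ext
    · rw [WeierstrassCurve.variableChange_a₁, hSLa₁, hW'La₁]; simp [U]
    · rw [WeierstrassCurve.variableChange_a₂, hSLa₁, hSLa₂, hUu]
      simp only [U, mul_zero, sub_zero, add_zero, zero_pow two_ne_zero]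
      rw [inv_pow, ← pow_mul, mul_comm kk 2, inv_mul_cancel_left₀ (pow_ne_zero _ hϖL0)]
    · rw [WeierstrassCurve.variableChange_a₃, hSLa₁, hSLa₃, hW'La₃]; simp [U]
    · rw [WeierstrassCurve.variableChange_a₄, hSLa₁, hSLa₃, hSLa₄, hUu]
      simp only [U, mul_zero, zero_mul, sub_zero, add_zero, zero_pow two_ne_zero]
      rw [inv_pow, ← pow_mul, mul_comm kk 4, inv_mul_cancel_left₀ (pow_ne_zero _ hϖL0)]
    · rw [WeierstrassCurve.variableChange_a₆, hSLa₁, hSLa₃, hSLa₆, hUu]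
      simp only [U, mul_zero, zero_mul, sub_zero, add_zero, zero_pow two_ne_zero,
        zero_pow three_ne_zero]
      rw [inv_pow, ← pow_mul, mul_comm kk 6, inv_mul_cancel_left₀ (pow_ne_zero _ hϖL0)]
  /- Step 4: the transport `A : E(ℚ̄) → W'(K̄_v)` and its `z`-coordinate. -/
  let σE : absoluteGaloisGroup (v.adicCompletion ℚ) →
      (AlgebraicClosure (v.adicCompletion ℚ) →ₐ[v.adicCompletion ℚ]
        AlgebraicClosure (v.adicCompletion ℚ)) := fun σ ↦
    ((absoluteGaloisGroup.toAlgEquiv (v.adicCompletion ℚ) σ :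
        AlgebraicClosure (v.adicCompletion ℚ) ≃ₐ[v.adicCompletion ℚ]
          AlgebraicClosure (v.adicCompletion ℚ)) :
      AlgebraicClosure (v.adicCompletion ℚ) →ₐ[v.adicCompletion ℚ]
        AlgebraicClosure (v.adicCompletion ℚ))
  have hσE : ∀ σ z, σE σ z = σ • z := fun σ z ↦ rfl
  -- the rescaling isomorphism `S(K̄_v) ≃ W'(K̄_v)`, made opaque (only its effect on coordinates is kept)
  obtain ⟨e₂, he₂⟩ : ∃ e₂ : SL.toAffine.Point ≃+ W'L.toAffine.Point,
      ∀ (x y : AlgebraicClosure (v.adicCompletion ℚ)) (h : SL.toAffine.Nonsingular x y),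
        ∃ h', e₂ (.some x y h) = .some (U.toX x) (U.toY x y) h' :=
    ⟨(VariableChange.pointEquiv SL U).trans (Affine.Point.congrEquiv hU), fun x y h ↦
      ⟨_, by rw [AddEquiv.trans_apply, VariableChange.pointEquiv_some, Affine.Point.congrEquiv_some]⟩⟩
  let A : geomPoints W →+ W'L.toAffine.Point :=
    ((Φ₀.trans e₂).toAddMonoidHom).comp (pointsMap W (v.adicCompletion ℚ))
  have hAdef : ∀ X, A X = e₂ (Φ₀ (pointsMap W (v.adicCompletion ℚ) X)) := fun X ↦ rfl
  have hAinj : Function.Injective A := fun X Y hXY ↦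
    pointsMapOfEmb_injective W (closureEmb (K := ℚ) (v.adicCompletion ℚ)) (Φ₀.injective (e₂.injective hXY))
  have hΦσ : ∀ (σ : absoluteGaloisGroup (v.adicCompletion ℚ)) (X : geomPoints W),
      Φ₀ (pointsMap W (v.adicCompletion ℚ) (absGaloisRestrict ℚ (v.adicCompletion ℚ) σ • X)) =
        Affine.Point.map (σE σ) (Φ₀ (pointsMap W (v.adicCompletion ℚ) X)) := by
    intro σ X
    rw [← resGal_eq_absGaloisRestrict, pointsMap_smul, hΦ₀]
  have hzΦσ : ∀ (σ : absoluteGaloisGroup (v.adicCompletion ℚ)) (X : geomPoints W),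
      (Φ₀ (pointsMap W (v.adicCompletion ℚ) (absGaloisRestrict ℚ (v.adicCompletion ℚ) σ • X))).zCoord =
        σ • (Φ₀ (pointsMap W (v.adicCompletion ℚ) X)).zCoord := by
    intro σ X
    rw [hΦσ]
    rcases Φ₀ (pointsMap W (v.adicCompletion ℚ) X) with _ | ⟨x, y, hxy⟩
    · rw [← Affine.Point.zero_def, Affine.Point.map_zero, Affine.Point.zCoord_zero, smul_zero]
    · rw [Affine.Point.map_some, Affine.Point.zCoord_some, Affine.Point.zCoord_some, hσE, hσE,
        absoluteGaloisGroup.smul_def, absoluteGaloisGroup.smul_def, absoluteGaloisGroup.smul_def,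
        map_div₀, map_neg]
  have hzA : ∀ X, (A X).zCoord = ϖL ^ kk * (Φ₀ (pointsMap W (v.adicCompletion ℚ) X)).zCoord := by
    intro X
    rw [hAdef]
    rcases Φ₀ (pointsMap W (v.adicCompletion ℚ) X) with _ | ⟨x, y, hxy⟩
    · rw [← Affine.Point.zero_def, map_zero, Affine.Point.zCoord_zero, Affine.Point.zCoord_zero, mul_zero]
    · obtain ⟨h', he⟩ := he₂ x y hxy
      rw [he, Affine.Point.zCoord_some, Affine.Point.zCoord_some, VariableChange.toX_def, VariableChange.toY_def,
        hUu]
      simp only [U, sub_zero, zero_mul]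
      by_cases hy : y = 0
      · rw [hy, mul_zero, div_zero, div_zero, mul_zero]
      · field_simp
  /- Step 5: `W' ⊗ K̄_v` is `w`-integral; on sub-row B every point of order `3` has `|x| · |ϖ| = 1`. -/
  haveI hint : W'L.IsIntegral w.integer := by
    refine isIntegral_of_exists_lift _ ⟨⟨_, ?_⟩, rfl⟩ ⟨⟨_, ?_⟩, rfl⟩ ⟨⟨_, ?_⟩, rfl⟩ ⟨⟨_, ?_⟩, rfl⟩
      ⟨⟨_, ?_⟩, rfl⟩
    all_goals exact (Valuation.mem_integer_iff _ _).mpr (hvO.map_le_one _)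
  -- sub-row B: `3 ∣ a₂'` (sub-row A is excluded by `hB`)
  have hBa₂ : (3 : O) ∣ W'.a₂ := by
    rcases hcases with ⟨hB1, -, -⟩ | ⟨-, ⟨hc₆, hval₆⟩, -⟩
    · exact hB1
    · exfalso
      rcases hB with h0 | hne
      · exact hc₆ h0
      · apply hne
        rw [hval₆, hΔval]
        rcases hkm with ⟨rfl, rfl⟩ | ⟨rfl, rfl⟩ <;> norm_num
  have htors : ∀ {x y : AlgebraicClosure (v.adicCompletion ℚ)} {h : W'L.toAffine.Nonsingular x y},
      addOrderOf (Affine.Point.some x y h : W'L.toAffine.Point) = 3 → w x * w ϖL = 1 :=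
    fun {x y h} h3 ↦ val_x_mul_val_eq_one_of_addOrderOf_eq_three v hw W' hunit hW'a₁ hW'a₃ hwϖ0 hwϖ1
      h3O hBa₂ h h3
  -- `A(E[3]) ⊆ E₁(W')` and `|z(A X)| = |π|` on `E[3] ∖ 0`
  have hker : ∀ X ∈ geomTorsion W 3, A X ∈ FormalGroupChart.kernel w W'L := by
    intro X hXt
    have h3X : (3 : ℤ) • A X = 0 := by
      rw [← map_zsmul, show ((3 : ℤ) • X) = 0 from mem_torsionBy_iff.mp hXt, A.map_zero]
    revert h3X
    rcases A X with _ | ⟨x, y, h⟩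
    · intro; rw [← Affine.Point.zero_def]; exact zero_mem _
    · intro h3X
      rw [FormalGroupChart.some_mem_kernel_iff h]
      have h3X' : 3 • (Affine.Point.some x y h : W'L.toAffine.Point) = 0 := by exact_mod_cast h3X
      have h3 : addOrderOf (Affine.Point.some x y h : W'L.toAffine.Point) = 3 :=
        addOrderOf_eq_prime_iff.mpr ⟨h3X', Affine.Point.some_ne_zero h⟩
      · have h1 := htors h3
        by_contra hle
        rw [not_lt] at hle
        have : w x * w ϖL < 1 := by
          calc w x * w ϖL ≤ 1 * w ϖL := by gcongr
            _ < 1 := by rw [one_mul]; exact hwϖ1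
        exact absurd h1 this.ne
  have hwz2 : ∀ X ∈ geomTorsion W 3, X ≠ 0 → w (A X).zCoord ^ 2 = w ϖL := by
    intro X hXt hX0
    have h3X : (3 : ℤ) • A X = 0 := by
      rw [← map_zsmul, show ((3 : ℤ) • X) = 0 from mem_torsionBy_iff.mp hXt, A.map_zero]
    have hkX : A X ∈ FormalGroupChart.kernel w W'L := hker X hXt
    have hA0 : A X ≠ 0 := fun h0 ↦ hX0 (hAinj (by rw [h0, A.map_zero]))
    revert h3X hkX hA0
    rcases A X with _ | ⟨x, y, h⟩
    · intro _ _ hA0; exact (hA0 (Affine.Point.zero_def).symm).elim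
    · intro h3X hkX _
      have h3X' : 3 • (Affine.Point.some x y h : W'L.toAffine.Point) = 0 := by exact_mod_cast h3X
      have h3 : addOrderOf (Affine.Point.some x y h : W'L.toAffine.Point) = 3 :=
        addOrderOf_eq_prime_iff.mpr ⟨h3X', Affine.Point.some_ne_zero h⟩
      have hx := htors h3
      obtain ⟨h1, -, -⟩ := FormalGroupChart.val_X_mul_val_zCoord_sq hkX
      rw [Affine.Point.zCoord_some]
      have hx0 : w x ≠ 0 := by
        intro h0; rw [h0, zero_mul] at hx; exact zero_ne_one hx
      calc w (-x / y) ^ 2 = (w x)⁻¹ * (w x * w (-x / y) ^ 2) := by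
            rw [← mul_assoc, inv_mul_cancel₀ hx0, one_mul]
        _ = (w x)⁻¹ * (w x * w ϖL) := by rw [h1, hx]
        _ = w ϖL := by rw [← mul_assoc, inv_mul_cancel₀ hx0, one_mul]
  have hzσ : ∀ (σ : absoluteGaloisGroup (v.adicCompletion ℚ)) (X : geomPoints W),
      (A (absGaloisRestrict ℚ (v.adicCompletion ℚ) σ • X)).zCoord = (ϖL / (σ • ϖL)) ^ kk * (σ • (A X).zCoord) := by
    intro σ X
    have hσϖ0 : σ • ϖL ≠ 0 := by
      rw [absoluteGaloisGroup.smul_def]; exact (map_ne_zero _).mpr hϖL0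
    rw [hzA, hzΦσ, hzA]
    rw [absoluteGaloisGroup.smul_def] at hσϖ0
    simp only [absoluteGaloisGroup.smul_def, map_mul, map_pow]
    rw [div_pow]
    field_simp
  exact ⟨kk, W'L, hint, A, by
    rcases hkm with ⟨hk, -⟩ | ⟨hk, -⟩
    · exact Or.inl ⟨by rw [hΔval, hk]; norm_num, hk⟩
    · exact Or.inr ⟨by rw [hΔval, hk]; norm_num, hk⟩, hAinj, hker, hwz2, hzσ⟩
end Summit.BirchSwinnertonDyer.BirchSwinnertonDyer.Theorems.TameQuarticManinParity

end
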